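/- Copyright: the b2b-balaban cell (near-miss cell 7), T⁴-continuum fan-out, NE7b swarm leaf 07 (gen 5; road W-RP, sub-row
«W3n» (offered), file 1 of 2: the COLUMN GEOMETRY under the top cells of the tower — sites, links, slabs, reflections).
Released under the licence of the surrounding project. -/
import Summits.QuantumFields.BalabanUV.T4Continuum.Support.HistoryRPTowerCells
import Literature.Barriers.CriticalPhenomena.PositionSpaceRGNonGibbsianChessboard

/-!
# History chessboard road: COLUMNS under the top cells of the tower — the finite geometry of `loc`∕`sym` (W3n, file 1)

Summits-side support leaf of the T⁴-continuum cell (rung (B)+1 on a FINITE torus only; NOT infinite volume, NOT the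
mass gap, NOT the Clay statement; NOT a proof of the spine estimate NE7b).  Road W-RP (R-OWNER-23-2 ∕ R-OWNER-23-8) of
the swarm claim table `t4/b2b-balaban-t4-ne7b-p1/LEAVES-NE7b.md`, sub-row «W3n» (leaf-07 g5's INTENT; the piece named by
leaf-04 g6 at seat-close for a successor: «column GEOMETRY for `loc`∕`sym` — top cells `halfPlus N i k`∕`cellReflect i k`
↔ bonds under a cell at lower levels»), file 1 of 2, on top of leaf-04 g6's W3m (`HistoryRPTowerCuts`: `cutVec`,
`cutPos`, `cutRefl`; `HistoryRPTowerCells`: descents, coordinate-level `loc`∕`sym`, `cutBond`).  [folklore] finite torus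
arithmetic in the tree's `Setup` vocabulary (`Site`, `PBond`, `blockOf`, `Site.scale`∕`scaleCoord`, `ZMod.val`); DATA
defs `links`, `under`, `slab`, `sref`; no `structure`, no `[cite:]` tag, no `Prop`-valued definition (c1), no constant
(c2∕c6), no exit ∕ socket ∕ `HistoryConstants` file (c3); nothing printed asserted.

WHY.  W4b′'s `CutoffReading` (leaf-06, `HistoryChessboardEventsCutoff`) on the tower carrier `Ω := Tower P G K` (top
lattice `Site P K = BlockIdx P.d (P.sitesPerDir K)`, `mP := cutPos G K`, `θ := cutRefl K`) has its five RP fields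
supplied by W3m file 1 and displays two GEOMETRIC clauses about the cell events `E l c`: `loc : ∀ c ∈ halfPlus N i k,
MeasurableSet[mP i k] (E l c)` and `sym : θ i k ⁻¹' E l c = E l (cellReflect i k c)`.  W3m file 2 reads single
coordinates; W3e (`HistoryRPBlocks`, leaf-06 g4) did the cell geometry for ONE level.  The natural support of a cell
event on the TOWER is the COLUMN under the top site `c` (at every level the sites whose iterated block is `c`), read
through the links INSIDE the column (both endpoints under `c` — W3e's `cellLinks` convention: a link across a block face
belongs to no cell).  This file is the finite geometry of columns; file 2 (`HistoryRPTowerColumnSigma`) builds the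
column σ-algebra and derives `loc`∕`sym` for column events.

WHAT.
* §1 `links S` (bonds of one level with BOTH endpoints in `S`), `under S` (the sites one level down whose `blockOf` lies
  in `S`), the positive `slab j i k` (`(y i − k).val < N_j ∕ 2`; = the chessboard's `halfPlus` on the top lattice,
  `mem_slab_iff_mem_halfPlus`), the reflection of sites in the hyperplane `(i, k)`, `sref j i k : y_i ↦ 2k − 1 − y_i`
  (= the chessboard's `cellReflect i k`, `sref_eq_cellReflect`, by `rfl`), `sref_sref`, `mem_image_sref_iff`.
* §2 LINKS: `translate_neg_cutVec_mem_posBonds` (a link inside the slab, translated back by the cut vector `k·e_i`, is a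
  positive bond — the hypothesis of W3m-2's `measurable_coord_of_translate_mem_posBonds`); the endpoints of W3m-2's
  `cutBond i (k·e_i) b`: **`cutBond_src_of_ne`∕`cutBond_tgt_of_ne`** (a bond across the axis: the reflected endpoints)
  and **`cutBond_src_of_eq`∕`cutBond_tgt_of_eq`** (an `i`-bond: the reflected endpoints SWAPPED), whence
  **`cutBond_mem_links`**: `cutBond` carries the links inside `S` to the links inside `S.image (sref j i k)`.
* §3 CROSS-LEVEL ARITHMETIC (standing range `j + 1 ≤ m + K`): `coord_eq_scaleCoord_add`, **`val_add_scaleCoord`** (the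
  label of `x_i + L·a` is `L·((blockOf x)_i + a).val + (x_i).val mod L` — no wrap-around), **`blockOf_add_scale`**
  (`blockOf (x + L·a) = blockOf x + a`: the lemma leaf-04 g6 asked for), **`sub_scaleCoord_pos_iff`** (a fine site is
  positive for the scaled cut `L·k` iff its block is positive for the cut `k` — the translated `blockOf_pos_iff`),
  `under_subset_slab`, **`blockOf_sref`** (the block of the site reflected in the scaled hyperplane is the reflected
  block: the tree's `blockOf_creflect` + `blockOf_add_scale`), **`under_image_sref`** (`under (sref '' S) = sref' ''
  (under S)` with the scaled parameter one level down).

HONEST SCOPE.  Finite torus geometry on OUR carriers; discharges nothing by itself (file 2 turns it into the `loc`∕`sym`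
suppliers for column events); which events model Bałaban's terms ((EXT)) and that they are column-supported ∕
reflection-compatible stays displayed on road W, as do (U1)∕(G2); the typing identification «`blockAvg ℰ` is (0.4)»
T-class.  Nothing of H3 ∕ (B) ∕ BetaPertH; NE7b NOT proved; spine 0∕9.  HONEST DEPENDENCY (cell): continuum YM on T⁴ ⇐
BetaPertH ∧ nine spine estimates (0/9 proved); BetaPertH ⇐ (D1) ∧ (D4) ∧ CAP+tail; G-an2-4 gates asym, D1 and NE2/3/4.
This file changes none of it. -/

open Literature.Barriers.CriticalPhenomena.NonGibbs
open Literature.MathematicalPhysics.QuantumFieldTheory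
open Literature.MathematicalPhysics.QuantumFieldTheory.Balaban1983to89
open Summit.QuantumFields.BalabanUV.T4Continuum.HistoryRPHalfTorus
open Summit.QuantumFields.BalabanUV.T4Continuum.HistoryRPTowerCuts
open Summit.QuantumFields.BalabanUV.T4Continuum.HistoryRPTowerCells

namespace Summit.QuantumFields.BalabanUV.T4Continuum.HistoryRPTowerColumns

noncomputable section

variable {P : Params}

/-! ## §1 Links inside a set of sites, the sites under it, the slab and the reflection of a cut -/

section Geometry

variable {j : ℕ}

/-- **THE LINKS INSIDE A SET OF SITES**: both endpoints in `S` (W3e's `cellLinks` convention). -/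
def links (S : Finset (Site P j)) : Finset (PBond P j) :=
  Finset.univ.filter fun b => b.src ∈ S ∧ b.tgt ∈ S

/-- membership in `links`. [folklore] -/
@[simp] theorem mem_links {S : Finset (Site P j)} {b : PBond P j} : b ∈ links S ↔ b.src ∈ S ∧ b.tgt ∈ S := by
  simp [links]

/-- **THE SITES ONE LEVEL DOWN UNDER `S`**: the fine sites whose block (`Setup.blockOf`) lies in `S`. -/
def under (S : Finset (Site P (j + 1))) : Finset (Site P j) :=
  Finset.univ.filter fun x => blockOf x ∈ S

/-- membership in `under`. [folklore] -/
@[simp] theorem mem_under {S : Finset (Site P (j + 1))} {x : Site P j} : x ∈ under S ↔ blockOf x ∈ S := by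
  simp [under]

variable (j) in
/-- **THE POSITIVE SLAB OF THE CUT `(i, k)`** at level `j`: sites with `i`-label in the band `[k, k + N_j ∕ 2)`. -/
def slab (i : Fin P.d) (k : ZMod (P.sitesPerDir j)) : Finset (Site P j) :=
  Finset.univ.filter fun y => (y i - k).val < P.sitesPerDir j / 2

/-- membership in `slab`. [folklore] -/
@[simp] theorem mem_slab {i : Fin P.d} {k : ZMod (P.sitesPerDir j)} {y : Site P j} :
    y ∈ slab j i k ↔ (y i - k).val < P.sitesPerDir j / 2 := by
  simp [slab]

/-- the slab IS the chessboard's positive half `halfPlus` of the top lattice (same letters: `Site P j` is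
`BlockIdx P.d (P.sitesPerDir j)`). [folklore] -/
theorem mem_slab_iff_mem_halfPlus {i : Fin P.d} {k : ZMod (P.sitesPerDir j)} {y : Site P j} :
    y ∈ slab j i k ↔ (y : BlockIdx P.d (P.sitesPerDir j)) ∈ halfPlus (P.sitesPerDir j) i k := by
  rw [mem_slab]
  exact (mem_halfPlus (c := (y : BlockIdx P.d (P.sitesPerDir j)))).symm

variable (j) in
/-- **THE REFLECTION OF SITES IN THE HYPERPLANE `(i, k)`**: `y_i ↦ 2k − 1 − y_i`, the other labels unchanged. -/
def sref (i : Fin P.d) (k : ZMod (P.sitesPerDir j)) (y : Site P j) : Site P j :=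
  Function.update y i (2 * k - 1 - y i)

/-- `sref` evaluated at the reflected label. [folklore] -/
@[simp] theorem sref_apply_same (i : Fin P.d) (k : ZMod (P.sitesPerDir j)) (y : Site P j) :
    sref j i k y i = 2 * k - 1 - y i := by
  simp [sref]

/-- `sref` evaluated at the other labels. [folklore] -/
theorem sref_apply_of_ne (i : Fin P.d) (k : ZMod (P.sitesPerDir j)) (y : Site P j) {ν : Fin P.d} (h : ν ≠ i) :
    sref j i k y ν = y ν := by
  simp [sref, h]

/-- `sref` IS the chessboard's `cellReflect` on the top lattice (same letters). [folklore] -/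
theorem sref_eq_cellReflect (i : Fin P.d) (k : ZMod (P.sitesPerDir j)) (y : Site P j) :
    sref j i k y = cellReflect i k (y : BlockIdx P.d (P.sitesPerDir j)) := rfl

/-- `sref` is an involution. [folklore] -/
theorem sref_sref (i : Fin P.d) (k : ZMod (P.sitesPerDir j)) (y : Site P j) : sref j i k (sref j i k y) = y := by
  funext ν
  by_cases h : ν = i
  · subst h; rw [sref_apply_same, sref_apply_same]; ring
  · rw [sref_apply_of_ne i k _ h, sref_apply_of_ne i k _ h]

/-- membership in the reflected set. [folklore] -/
theorem mem_image_sref_iff (i : Fin P.d) (k : ZMod (P.sitesPerDir j)) {S : Finset (Site P j)} {y : Site P j} :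
    y ∈ S.image (sref j i k) ↔ sref j i k y ∈ S := by
  constructor
  · intro h
    obtain ⟨z, hz, hzy⟩ := Finset.mem_image.1 h
    rw [← hzy, sref_sref]
    exact hz
  · intro h
    exact Finset.mem_image.2 ⟨sref j i k y, h, sref_sref i k y⟩

/-- coordinates of a negated lattice vector. [folklore] -/
theorem neg_apply' (a : Site P j) (ν : Fin P.d) : (-a) ν = -(a ν) := rfl

/-- coordinates of a difference of lattice vectors. [folklore] -/
theorem sub_apply' (a a' : Site P j) (ν : Fin P.d) : (a - a') ν = a ν - a' ν := rfl

/-- the cut vector evaluated at its axis: `(k·e_i) i = k`. [folklore] -/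
@[simp] theorem cutVec_apply_same (i : Fin P.d) (k : ZMod (P.sitesPerDir j)) : cutVec j i k i = k := by
  simp [cutVec]

/-- the cut vector evaluated off its axis: `(k·e_i) ν = 0`. [folklore] -/
theorem cutVec_apply_of_ne (i : Fin P.d) (k : ZMod (P.sitesPerDir j)) {ν : Fin P.d} (h : ν ≠ i) :
    cutVec j i k ν = 0 := by
  simp [cutVec, h]

/-- **A LINK INSIDE THE SLAB, TRANSLATED BACK BY THE CUT VECTOR, IS A POSITIVE BOND** (the hypothesis of W3m-2's
`measurable_coord_of_translate_mem_posBonds`). [folklore] -/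
theorem translate_neg_cutVec_mem_posBonds (i : Fin P.d) (k : ZMod (P.sitesPerDir j)) {b : PBond P j}
    (hs : b.src ∈ slab j i k) (ht : b.tgt ∈ slab j i k) : b.translate (-cutVec j i k) ∈ posBonds P j i := by
  rw [mem_slab] at hs ht
  rw [mem_posBonds, PBond.translate_tgt, PBond.translate_src, Site.add_apply, Site.add_apply, neg_apply', cutVec_apply_same,
    ← sub_eq_add_neg, ← sub_eq_add_neg]
  exact ⟨hs, ht⟩

/-! ## §2 Links: positivity for the cut, and the endpoints of W3m's cut-reflected bond `cutBond` -/

/-- `sref` as the CONJUGATED centre reflection: translate by `−k·e_i`, reflect `n ↦ −n − 1`, translate back.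
[folklore] -/
theorem sref_eq_conj (i : Fin P.d) (k : ZMod (P.sitesPerDir j)) (y : Site P j) :
    sref j i k y = ((y - cutVec j i k).reflect i).unshift i + cutVec j i k := by
  funext ν
  by_cases hν : ν = i
  · subst hν
    rw [sref_apply_same, Site.add_apply, Site.unshift_apply, if_pos rfl, Site.reflect_apply, if_pos rfl, sub_apply',
      cutVec_apply_same]
    ring
  · rw [sref_apply_of_ne i k y hν, Site.add_apply, Site.unshift_apply, if_neg hν, Site.reflect_apply, if_neg hν,
      sub_apply', cutVec_apply_of_ne i k hν, sub_zero, add_zero]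

/-- `sref` commutes with the unit step in a direction other than `i`. [folklore] -/
theorem sref_shift_of_ne (i : Fin P.d) (k : ZMod (P.sitesPerDir j)) (y : Site P j) {μ : Fin P.d} (h : μ ≠ i) :
    sref j i k (y.shift μ) = (sref j i k y).shift μ := by
  funext ν
  by_cases hν : ν = i
  · subst hν
    rw [sref_apply_same, Site.shift_apply, if_neg (Ne.symm h), Site.shift_apply, if_neg (Ne.symm h), sref_apply_same]
  · rw [sref_apply_of_ne i k _ hν, Site.shift_apply, Site.shift_apply]
    by_cases hμ : ν = μ
    · subst hμ
      rw [if_pos rfl, if_pos rfl, sref_apply_of_ne i k _ hν]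
    · rw [if_neg hμ, if_neg hμ, sref_apply_of_ne i k _ hν]

/-- the unit step after reflecting the stepped site: `(sref (y + e_i)) + e_i = sref y`. [folklore] -/
theorem sref_shift_shift_same (i : Fin P.d) (k : ZMod (P.sitesPerDir j)) (y : Site P j) :
    (sref j i k (y.shift i)).shift i = sref j i k y := by
  funext ν
  by_cases hν : ν = i
  · subst hν
    rw [Site.shift_apply, if_pos rfl, sref_apply_same, Site.shift_apply, if_pos rfl, sref_apply_same]
    ring
  · rw [Site.shift_apply, if_neg hν, sref_apply_of_ne i k _ hν, Site.shift_apply, if_neg hν,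
      sref_apply_of_ne i k _ hν]

/-- **THE SOURCE OF `cutBond` ON A BOND ACROSS THE AXIS** is the reflected source. [folklore] -/
theorem cutBond_src_of_ne (i : Fin P.d) (k : ZMod (P.sitesPerDir j)) (b : PBond P j) (h : b.dir ≠ i) :
    (cutBond i (cutVec j i k) b).src = sref j i k b.src := by
  rw [sref_eq_conj]
  show ((b.translate (-cutVec j i k)).reflect i).src + (0 : Site P j).unshift i + cutVec j i k = _
  rw [Site.add_zero_unshift, PBond.reflect_src_of_ne i (b.translate (-cutVec j i k)) h, PBond.translate_src,
    ← sub_eq_add_neg]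

/-- **THE TARGET OF `cutBond` ON A BOND ACROSS THE AXIS** is the reflected target. [folklore] -/
theorem cutBond_tgt_of_ne (i : Fin P.d) (k : ZMod (P.sitesPerDir j)) (b : PBond P j) (h : b.dir ≠ i) :
    (cutBond i (cutVec j i k) b).tgt = sref j i k b.tgt := by
  show (cutBond i (cutVec j i k) b).src.shift (cutBond i (cutVec j i k) b).dir = sref j i k (b.src.shift b.dir)
  rw [cutBond_src_of_ne i k b h, cutBond_dir, sref_shift_of_ne i k b.src h]

/-- **THE SOURCE OF `cutBond` ON AN `i`-BOND** is the reflected TARGET. [folklore] -/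
theorem cutBond_src_of_eq (i : Fin P.d) (k : ZMod (P.sitesPerDir j)) (b : PBond P j) (h : b.dir = i) :
    (cutBond i (cutVec j i k) b).src = sref j i k b.tgt := by
  rw [sref_eq_conj]
  show ((b.translate (-cutVec j i k)).reflect i).src + (0 : Site P j).unshift i + cutVec j i k =
    ((b.src.shift b.dir - cutVec j i k).reflect i).unshift i + cutVec j i k
  rw [Site.add_zero_unshift, PBond.reflect_src_of_eq i (b.translate (-cutVec j i k)) h, PBond.translate_src,
    Site.shift_add, ← sub_eq_add_neg, h]

/-- **THE TARGET OF `cutBond` ON AN `i`-BOND** is the reflected SOURCE. [folklore] -/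
theorem cutBond_tgt_of_eq (i : Fin P.d) (k : ZMod (P.sitesPerDir j)) (b : PBond P j) (h : b.dir = i) :
    (cutBond i (cutVec j i k) b).tgt = sref j i k b.src := by
  show (cutBond i (cutVec j i k) b).src.shift (cutBond i (cutVec j i k) b).dir = _
  rw [cutBond_src_of_eq i k b h, cutBond_dir]
  show (sref j i k (b.src.shift b.dir)).shift b.dir = sref j i k b.src
  rw [h, sref_shift_shift_same]

/-- **`cutBond` CARRIES THE LINKS INSIDE `S` TO THE LINKS INSIDE THE REFLECTED SET.** [folklore] -/
theorem cutBond_mem_links (i : Fin P.d) (k : ZMod (P.sitesPerDir j)) {S : Finset (Site P j)} {b : PBond P j}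
    (hb : b ∈ links S) : cutBond i (cutVec j i k) b ∈ links (S.image (sref j i k)) := by
  rw [mem_links] at hb ⊢
  by_cases h : b.dir = i
  · rw [cutBond_src_of_eq i k b h, cutBond_tgt_of_eq i k b h]
    exact ⟨Finset.mem_image_of_mem _ hb.2, Finset.mem_image_of_mem _ hb.1⟩
  · rw [cutBond_src_of_ne i k b h, cutBond_tgt_of_ne i k b h]
    exact ⟨Finset.mem_image_of_mem _ hb.1, Finset.mem_image_of_mem _ hb.2⟩

/-! ## §3 Cross-level arithmetic (standing range `j + 1 ≤ m + K`) -/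

/-- a fine label is `L·(its block label) + (its remainder mod L)`. [folklore] -/
theorem coord_eq_scaleCoord_add (hj : j + 1 ≤ P.m + P.K) (x : Site P j) (i : Fin P.d) :
    x i = Site.scaleCoord P j ((blockOf x) i) + (((x i).val % P.L : ℕ) : ZMod (P.sitesPerDir j)) := by
  rw [Site.scaleCoord_apply, Site.val_blockOf hj, ← Nat.cast_add, Nat.div_add_mod', ZMod.natCast_zmod_val]

/-- **THE LABEL OF `x_i + L·a`**: `L·((blockOf x)_i + a).val + (x_i).val mod L` (no wrap-around in the standing
range). [folklore] -/
theorem val_add_scaleCoord (hj : j + 1 ≤ P.m + P.K) (x : Site P j) (i : Fin P.d) (a : ZMod (P.sitesPerDir (j + 1))) :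
    (x i + Site.scaleCoord P j a).val = ((blockOf x) i + a).val * P.L + (x i).val % P.L := by
  have hs : (x i).val % P.L < P.L := Nat.mod_lt _ P.L_pos
  have hr : ((blockOf x) i + a).val < P.sitesPerDir (j + 1) := ZMod.val_lt _
  have hN : P.sitesPerDir j = P.sitesPerDir (j + 1) * P.L := P.sitesPerDir_eq_mul_succ hj
  have hlt : ((blockOf x) i + a).val * P.L + (x i).val % P.L < P.sitesPerDir j := by
    have h1 : (((blockOf x) i + a).val + 1) * P.L ≤ P.sitesPerDir (j + 1) * P.L := Nat.mul_le_mul_right _ hr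
    rw [Nat.add_mul, one_mul] at h1
    omega
  have e : x i + Site.scaleCoord P j a =
      ((((blockOf x) i + a).val * P.L + (x i).val % P.L : ℕ) : ZMod (P.sitesPerDir j)) := by
    rw [Nat.cast_add, ← Site.scaleCoord_apply, map_add, add_right_comm, ← coord_eq_scaleCoord_add hj x i]
  rw [e, ZMod.val_natCast, Nat.mod_eq_of_lt hlt]

/-- **`blockOf (x + L·a) = blockOf x + a`**: the block map intertwines the fine translation by `scale a` with the
coarse translation by `a` (standing range). [folklore] -/
theorem blockOf_add_scale (hj : j + 1 ≤ P.m + P.K) (x : Site P j) (a : Site P (j + 1)) :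
    blockOf (x + Site.scale a) = blockOf x + a := by
  funext i
  apply ZMod.val_injective
  rw [Site.val_blockOf hj, Site.add_apply, Site.scale_apply, val_add_scaleCoord hj, Site.add_apply, mul_comm,
    Nat.mul_add_div P.L_pos, Nat.div_eq_of_lt (Nat.mod_lt _ P.L_pos), add_zero]

/-- **POSITIVITY FOR THE SCALED CUT IS READ ON BLOCKS**: `x_i − L·k` is a positive label of level `j` iff
`(blockOf x)_i − k` is a positive label of level `j + 1` (the translated `blockOf_pos_iff`; standing range).
[folklore] -/
theorem sub_scaleCoord_pos_iff (hj : j + 1 ≤ P.m + P.K) (x : Site P j) (i : Fin P.d)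
    (k : ZMod (P.sitesPerDir (j + 1))) :
    (x i - Site.scaleCoord P j k).val < P.sitesPerDir j / 2 ↔
      ((blockOf x) i - k).val < P.sitesPerDir (j + 1) / 2 := by
  rw [sub_eq_add_neg, ← map_neg, val_add_scaleCoord hj, ← sub_eq_add_neg, half_sitesPerDir_eq_mul hj]
  have hs : (x i).val % P.L < P.L := Nat.mod_lt _ P.L_pos
  constructor
  · intro hlt
    exact Nat.lt_of_mul_lt_mul_right (lt_of_le_of_lt (Nat.le_add_right _ _) hlt)
  · intro hlt
    have h1 : (((blockOf x) i - k).val + 1) * P.L ≤ P.sitesPerDir (j + 1) / 2 * P.L := Nat.mul_le_mul_right _ hlt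
    rw [Nat.add_mul, one_mul] at h1
    omega

/-- the slab one level down: the sites under slab sites lie in the slab of the SCALED cut `L·k`. [folklore] -/
theorem under_subset_slab (hj : j + 1 ≤ P.m + P.K) (i : Fin P.d) (k : ZMod (P.sitesPerDir (j + 1)))
    {S : Finset (Site P (j + 1))} (hS : S ⊆ slab (j + 1) i k) : under S ⊆ slab j i (Site.scaleCoord P j k) := by
  intro x hx
  rw [mem_under] at hx
  rw [mem_slab, sub_scaleCoord_pos_iff hj]
  exact mem_slab.1 (hS hx)

/-- `sref` as «translate by `−2k·e_i`, then `n ↦ −n − 1`» (the form of the tree's `blockOf_creflect`). [folklore] -/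
theorem sref_eq_creflSite_sub (i : Fin P.d) (k : ZMod (P.sitesPerDir j)) (y : Site P j) :
    sref j i k y = ((y - cutVec j i (2 * k)).reflect i).unshift i := by
  funext ν
  by_cases hν : ν = i
  · subst hν
    rw [sref_apply_same, Site.unshift_apply, if_pos rfl, Site.reflect_apply, if_pos rfl, sub_apply', cutVec_apply_same]
    ring
  · rw [sref_apply_of_ne i k y hν, Site.unshift_apply, if_neg hν, Site.reflect_apply, if_neg hν, sub_apply',
      cutVec_apply_of_ne i (2 * k) hν, sub_zero]

/-- **THE BLOCK OF A SITE REFLECTED IN THE SCALED HYPERPLANE IS THE REFLECTED BLOCK** (`blockOf_creflect` of the tree +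
`blockOf_add_scale`; standing range). [folklore] -/
theorem blockOf_sref (hj : j + 1 ≤ P.m + P.K) (i : Fin P.d) (k : ZMod (P.sitesPerDir (j + 1))) (x : Site P j) :
    blockOf (sref j i (Site.scaleCoord P j k) x) = sref (j + 1) i k (blockOf x) := by
  have h2 : cutVec j i (2 * Site.scaleCoord P j k) = Site.scale (cutVec (j + 1) i (2 * k)) := by
    rw [two_mul, ← map_add, ← two_mul, scale_cutVec]
  have e : x - cutVec j i (2 * Site.scaleCoord P j k) = x + Site.scale (-cutVec (j + 1) i (2 * k)) := by
    rw [map_neg, h2, sub_eq_add_neg]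
  rw [sref_eq_creflSite_sub, sref_eq_creflSite_sub, blockOf_creflect hj, e, blockOf_add_scale hj, ← sub_eq_add_neg]

/-- **THE SITES UNDER THE REFLECTED SET ARE THE REFLECTED SITES UNDER THE SET** (reflection in the scaled hyperplane one
level down). [folklore] -/
theorem under_image_sref (hj : j + 1 ≤ P.m + P.K) (i : Fin P.d) (k : ZMod (P.sitesPerDir (j + 1)))
    (S : Finset (Site P (j + 1))) :
    under (S.image (sref (j + 1) i k)) = (under S).image (sref j i (Site.scaleCoord P j k)) := by
  ext x
  rw [mem_under, mem_image_sref_iff, mem_image_sref_iff, mem_under, blockOf_sref hj]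

end Geometry

/-! ## §4 Sanity -/

section Sanity

/-- the top lattice of the chessboard reading and the top level of the tower are the same type (no transport). -/
example (K : ℕ) : Site P K = BlockIdx P.d (P.sitesPerDir K) := rfl

/-- decided toy (`d = 1`, `L = 3`, `m = 2`, `K = 0`, level `1`: six labels): the reflection in the hyperplane `k = 2`
sends the label `1` to `2·2 − 1 − 1 = 2` (the cells `1 ∣ 2` are mirror images across the cut between them). -/
example : sref (P := ⟨1, 3, 2, 0, le_rfl, by decide⟩) 1 (0 : Fin 1) 2 (fun _ => 1) 0 = 2 := by
  rw [sref_apply_same]; decide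

end Sanity

end

end Summit.QuantumFields.BalabanUV.T4Continuum.HistoryRPTowerColumns
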